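import Mathlib
import HarnessLib
import Summits.Ventures.LatticeQCDFlow.Exactness.CPNHeatBathErgodic
import Summits.Ventures.LatticeQCDFlow.Exactness.CPNMetropolisSiteKernel
import Summits.Ventures.LatticeQCDFlow.Exactness.CPNLinkRotationKick
import Summits.Ventures.LatticeQCDFlow.Exactness.SiteMetropolisScan

/-!
# The `cpn_2d` Metropolis sweep (angular-Gaussian site kicks, wrapped-Gaussian link kicks) converges to the lattice CP(N−1) law from every start

HONEST FRAMING: exact (Metropolis-corrected) sampling algorithms for lattice gauge theory;
figures of merit are autocorrelation/cost numbers at stated couplings and volumes; no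
continuum-physics claim.

Venture `LatticeQCDFlow` (cell pub-lqcd), topic `Exactness`, FANOUT row 9 (eng-latcore, the
engine `latflow.core.cpn_2d` in mode `'metro'`: `metropolis_sites` + `metropolis_links`, each a
single-variable Metropolis hit with the others frozen).  NEW WORK of the cell, one screen over the
tree: `CPNHeatBathErgodic.lean` (`CPNConfig`, `cpnRef`, `cpnAction`, `cpnGibbsLaw`, continuity of
the action), `SiteMetropolisScan.lean` (generic Metropolis-within-Gibbs: exact for symmetric
proposals, Doeblin when they dominate the reference), `CPNMetropolisSiteKernel.lean`
(`angularGaussKernel`: uniformSphere-symmetric), `CPNMetropolisKicks.lean` (site kick Doeblin),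
`CPNLinkRotationKick.lean` (`circleRotKernel`: symmetric and Doeblin).  Nothing is cited as a fact.

* `cpnMetroProposal εs εl i` — the proposal kernels: `angularGaussKernel εs` on sites,
  `circleRotKernel εl` on links; `cpnMetropolisSweep` — the scan of single-variable Metropolis hits
  for the weight `e^{−S}`, `S = cpnAction`, over a list of variables;
  `cpnMetroProposal_symm`, `smul_cpnRef_le_cpnMetroProposal` (one constant `cpnMetroConst > 0`, finite);
* **`cpn_metropolisSweep_invariant`** — the sweep leaves `e^{−S} · ⊗(uniform)` invariant (EXACT);
* **`cpn_metropolisSweep_uniformlyErgodic`** — for `εs > 0`, `εl > 0` and every list visiting every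
  site and link there is an explicit `δ ∈ (0, 1]` with `|μ₀Kᵗ(A) − π(A)| ≤ (1 − δ)ᵗ` for EVERY initial
  law, `π = cpnGibbsLaw`;  **`cpnGibbsLaw_unique_invariant_metropolis`**.

NOT CLAIMED: any useful rate (the constant is a product of one-kick Doeblin constants); the
Symanzik-improved action; the `'hb'`/`'hybrid'` modes (see `CPNHeatBathErgodic.lean`); floating point.
-/

noncomputable section

namespace Summit.Ventures.LatticeQCDFlow.Exactness

open MeasureTheory ProbabilityTheory Metric Set Function
open scoped ENNReal

section CPNMetro

variable (V E : Type*) [Fintype V] [Fintype E] [DecidableEq V] [DecidableEq E] (d : ℕ)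

/-- **The `cpn_2d` 'metro' proposal kernels**: the angular-Gaussian kick on sites, the rotation
kick on links. -/
def cpnMetroProposal (εs εl : ℝ) : (i : V ⊕ E) → Kernel (CPNVar V E d i) (CPNVar V E d i)
  | Sum.inl _ => angularGaussKernel εs
  | Sum.inr _ => circleRotKernel εl

/-- Every proposal kernel is Markov. -/
instance isMarkovKernel_cpnMetroProposal (εs εl : ℝ) (i : V ⊕ E) :
    IsMarkovKernel (cpnMetroProposal V E d εs εl i) := by
  cases i with
  | inl v => show IsMarkovKernel (angularGaussKernel εs); infer_instance
  | inr e => show IsMarkovKernel (circleRotKernel εl); infer_instance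

variable {V E d}
variable (src tgt : E → V) (J : EuclideanSpace ℝ (Fin (d + 2)) →L[ℝ] EuclideanSpace ℝ (Fin (d + 2))) (c : E → ℝ)

/-- The Metropolis weight `e^{−S}` as a real function. -/
def cpnWeight (ω : CPNConfig V E d) : ℝ := Real.exp (-cpnAction src tgt J c ω)

/-- **The `cpn_2d` Metropolis sweep**: the scan, over the list `l`, of single-variable Metropolis
hits with the proposals above and the weight `e^{−S}`. -/
def cpnMetropolisSweep (εs εl : ℝ) (l : List (V ⊕ E)) : Kernel (CPNConfig V E d) (CPNConfig V E d) :=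
  cycle (l.map (siteMetropolis (cpnMetroProposal V E d εs εl) (cpnWeight src tgt J c)))

omit [DecidableEq V] [DecidableEq E] in
/-- The weight is measurable. -/
theorem measurable_cpnWeight : Measurable (cpnWeight src tgt J c) :=
  (Real.measurable_exp.comp (continuous_cpnAction src tgt J c).measurable.neg)

omit [Fintype V] [Fintype E] [DecidableEq V] [DecidableEq E] in
/-- **Every proposal is symmetric for its uniform reference law** (`εs ≠ 0`). -/
theorem cpnMetroProposal_symm {εs : ℝ} (hεs : εs ≠ 0) (εl : ℝ) (i : V ⊕ E) :
    ((cpnRef V E d i) ⊗ₘ cpnMetroProposal V E d εs εl i).map Prod.swap =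
      (cpnRef V E d i) ⊗ₘ cpnMetroProposal V E d εs εl i := by
  cases i with
  | inl v => exact compProd_angularGaussKernel_swap hεs
  | inr e => exact compProd_circleRotKernel_swap εl

variable (d) in
/-- One Doeblin constant for all variables: the minimum of the site and link one-kick constants. -/
def cpnMetroConst (εs εl : ℝ) : ℝ≥0∞ :=
  min (gaussRadial (Fintype.card (Fin (d + 2))) (2 / εs) *
      (ENNReal.ofReal |(εs ^ Module.finrank ℝ (EuclideanSpace ℝ (Fin (d + 2))))⁻¹| *
        volume (ball (0 : EuclideanSpace ℝ (Fin (d + 2))) 1)))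
    (ENNReal.ofReal (gaussianPDFReal 0 1 (Real.pi / εl)) * ENNReal.ofReal εl⁻¹ * ENNReal.ofReal (2 * Real.pi))

/-- The constant is positive for `εs ≠ 0`, `εl > 0`. -/
theorem cpnMetroConst_ne_zero {εs εl : ℝ} (hεs : εs ≠ 0) (hεl : 0 < εl) : cpnMetroConst d εs εl ≠ 0 := by
  unfold cpnMetroConst gaussRadial
  refine (lt_min ?_ ?_).ne'
  · refine ENNReal.mul_pos (by rw [Ne, ENNReal.ofReal_eq_zero, not_le]; positivity) (ENNReal.mul_pos ?_ ?_).ne' |>.ne' |> fun h => pos_iff_ne_zero.2 h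
    · rw [Ne, ENNReal.ofReal_eq_zero, not_le, abs_pos]
      exact inv_ne_zero (pow_ne_zero _ hεs)
    · exact (measure_ball_pos volume _ one_pos).ne'
  · refine pos_iff_ne_zero.2 (mul_ne_zero (mul_ne_zero ?_ ?_) ?_)
    · rw [Ne, ENNReal.ofReal_eq_zero, not_le]; exact gaussianPDFReal_pos _ _ _ one_ne_zero
    · rw [Ne, ENNReal.ofReal_eq_zero, not_le]; exact inv_pos.2 hεl
    · rw [Ne, ENNReal.ofReal_eq_zero, not_le]; positivity

omit [Fintype V] [Fintype E] [DecidableEq V] [DecidableEq E] in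
/-- **Every proposal dominates `cpnMetroConst ×` its uniform reference from every point**
(`εs > 0`, `εl > 0`). -/
theorem smul_cpnRef_le_cpnMetroProposal {εs εl : ℝ} (hεs : 0 < εs) (hεl : 0 < εl) (i : V ⊕ E)
    (x : CPNVar V E d i) : cpnMetroConst d εs εl • cpnRef V E d i ≤ cpnMetroProposal V E d εs εl i x := by
  cases i with
  | inl v =>
      show cpnMetroConst d εs εl • uniformSphere (volume : Measure (EuclideanSpace ℝ (Fin (d + 2)))) ≤
        angularGaussKernel (ι := Fin (d + 2)) εs x
      rw [angularGaussKernel_apply]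
      have hx : ‖(x.1 : EuclideanSpace ℝ (Fin (d + 2)))‖ ≤ 1 := le_of_eq (mem_sphere_zero_iff_norm.1 x.2)
      refine le_trans (Measure.le_iff'.2 fun A => ?_) (smul_uniformSphere_le_angularGaussKick hεs hx)
      simp only [Measure.smul_apply, smul_eq_mul]
      exact mul_le_mul' (min_le_left _ _) le_rfl
  | inr e =>
      show cpnMetroConst d εs εl • uniformSphere (volume : Measure E2) ≤ circleRotKernel εl x
      rw [circleRotKernel_apply]
      refine le_trans (Measure.le_iff'.2 fun A => ?_) (smul_uniformSphere_le_circleRotKick hεl x)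
      simp only [Measure.smul_apply, smul_eq_mul]
      exact mul_le_mul' (min_le_right _ _) le_rfl

/-- **THE `cpn_2d` METROPOLIS SWEEP IS EXACT**: it leaves `e^{−S} · ⊗(uniform)` invariant
(`εs ≠ 0`; any list of variables). -/
theorem cpn_metropolisSweep_invariant {εs : ℝ} (hεs : εs ≠ 0) (εl : ℝ) (l : List (V ⊕ E)) :
    Kernel.Invariant (cpnMetropolisSweep src tgt J c εs εl l)
      ((Measure.pi (cpnRef V E d)).withDensity (gibbsDensity (cpnAction src tgt J c))) :=
  metropolisScan_invariant (μ := cpnRef V E d) (measurable_cpnWeight src tgt J c) (fun _ => Real.exp_pos _)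
    (cpnMetroProposal_symm hεs εl) l

/-- **THE `cpn_2d` METROPOLIS SWEEP CONVERGES TO THE LATTICE CP(N−1) LAW FROM EVERY START**: for
`εs > 0`, `εl > 0` and every list visiting every site and every link there is `δ ∈ (0, 1]` with
`|μ₀Kᵗ(A) − π(A)| ≤ (1 − δ)ᵗ` for every initial law, every `t`, every measurable set, `π = cpnGibbsLaw`. -/
theorem cpn_metropolisSweep_uniformlyErgodic {εs εl : ℝ} (hεs : 0 < εs) (hεl : 0 < εl) {l : List (V ⊕ E)}
    (hl : ∀ i, i ∈ l) :
    ∃ δ : ℝ, 0 < δ ∧ δ ≤ 1 ∧ ∀ (μ₀ : Measure (CPNConfig V E d)) [IsProbabilityMeasure μ₀] (t : ℕ)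
      (A : Set (CPNConfig V E d)),
      |((fun ν : Measure (CPNConfig V E d) => ν.bind (cpnMetropolisSweep src tgt J c εs εl l))^[t] μ₀).real A
          - (cpnGibbsLaw src tgt J c).real A| ≤ (1 - δ) ^ t := by
  have hS := continuous_cpnAction src tgt J c
  have hw := measurable_cpnWeight src tgt J c
  haveI := isMarkovKernel_metropolisScan (P := cpnMetroProposal V E d εs εl) hw l
  rcases isEmpty_or_nonempty (CPNConfig V E d) with hE | hne
  · refine ⟨1, one_pos, le_rfl, fun μ₀ _ t A => ?_⟩
    exact absurd (measure_univ (μ := μ₀)) (by rw [Set.univ_eq_empty_iff.2 hE, measure_empty]; exact zero_ne_one)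
  obtain ⟨ωa, -, hmin⟩ := isCompact_univ.exists_isMinOn Set.univ_nonempty hS.continuousOn
  obtain ⟨ωb, -, hmax⟩ := isCompact_univ.exists_isMaxOn Set.univ_nonempty hS.continuousOn
  have hωa : ∀ ω, cpnAction src tgt J c ωa ≤ cpnAction src tgt J c ω := fun ω => (isMinOn_iff.1 hmin) ω (Set.mem_univ ω)
  have hωb : ∀ ω, cpnAction src tgt J c ω ≤ cpnAction src tgt J c ωb := fun ω => (isMaxOn_iff.1 hmax) ω (Set.mem_univ ω)
  set m : ℝ := Real.exp (-cpnAction src tgt J c ωb) with hm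
  set M : ℝ := Real.exp (-cpnAction src tgt J c ωa) with hM
  have hm0 : 0 < m := Real.exp_pos _
  have hwm : ∀ ω, m ≤ cpnWeight src tgt J c ω := fun ω => Real.exp_le_exp.2 (neg_le_neg (hωb ω))
  have hwM : ∀ ω, cpnWeight src tgt J c ω ≤ M := fun ω => Real.exp_le_exp.2 (neg_le_neg (hωa ω))
  have hmin := metropolisScan_minorised (μ := cpnRef V E d) (P := cpnMetroProposal V E d εs εl) hw hm0 hwm hwM
    (smul_cpnRef_le_cpnMetroProposal hεs hεl) hl
  set δE : ℝ≥0∞ := (cpnMetroConst d εs εl * ENNReal.ofReal (m / M)) ^ l.length with hδE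
  -- `δ ≤ 1` from the minorisation at `univ`, `0 < δ` from the positivity and finiteness of the constant
  have hδ1 : δE ≤ 1 := by
    have h := Measure.le_iff'.1 (hmin ωa) Set.univ
    rw [Measure.smul_apply, smul_eq_mul, measure_univ, mul_one] at h
    exact h.trans prob_le_one
  have hδ0 : δE ≠ 0 := pow_ne_zero _ (mul_ne_zero (cpnMetroConst_ne_zero hεs.ne' hεl)
    (by rw [Ne, ENNReal.ofReal_eq_zero, not_le]; exact div_pos hm0 (Real.exp_pos _)))
  have hδtop : δE ≠ ⊤ := ne_top_of_le_ne_top ENNReal.one_ne_top hδ1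
  refine ⟨δE.toReal, ENNReal.toReal_pos hδ0 hδtop, ?_, fun μ₀ _ t A => ?_⟩
  · exact ENNReal.toReal_le_of_le_ofReal zero_le_one (by rwa [ENNReal.ofReal_one])
  · exact metropolisScan_uniformlyErgodic (μ := cpnRef V E d) (P := cpnMetroProposal V E d εs εl) hw hm0 hwm hwM
      (cpnMetroProposal_symm hεs.ne' εl) (smul_cpnRef_le_cpnMetroProposal hεs hεl) hl μ₀ t A

/-- **The lattice CP(N−1) law is the unique invariant probability law of the `cpn_2d` Metropolis
sweep** (`εs > 0`, `εl > 0`, the list visits every variable). -/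
theorem cpnGibbsLaw_unique_invariant_metropolis {εs εl : ℝ} (hεs : 0 < εs) (hεl : 0 < εl)
    {l : List (V ⊕ E)} (hl : ∀ i, i ∈ l) {π' : Measure (CPNConfig V E d)} [IsProbabilityMeasure π']
    (hπ' : Kernel.Invariant (cpnMetropolisSweep src tgt J c εs εl l) π') :
    π' = cpnGibbsLaw src tgt J c := by
  have hS := continuous_cpnAction src tgt J c
  have hw := measurable_cpnWeight src tgt J c
  rcases isEmpty_or_nonempty (CPNConfig V E d) with hE | hne
  · exact absurd (measure_univ (μ := π')) (by rw [Set.univ_eq_empty_iff.2 hE, measure_empty]; exact zero_ne_one)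
  obtain ⟨ωa, -, hmin⟩ := isCompact_univ.exists_isMinOn Set.univ_nonempty hS.continuousOn
  obtain ⟨ωb, -, hmax⟩ := isCompact_univ.exists_isMaxOn Set.univ_nonempty hS.continuousOn
  have hωa : ∀ ω, cpnAction src tgt J c ωa ≤ cpnAction src tgt J c ω := fun ω => (isMinOn_iff.1 hmin) ω (Set.mem_univ ω)
  have hωb : ∀ ω, cpnAction src tgt J c ω ≤ cpnAction src tgt J c ωb := fun ω => (isMaxOn_iff.1 hmax) ω (Set.mem_univ ω)
  exact metropolisScan_invariant_unique (μ := cpnRef V E d) (P := cpnMetroProposal V E d εs εl) hw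
    (m := Real.exp (-cpnAction src tgt J c ωb)) (M := Real.exp (-cpnAction src tgt J c ωa)) (Real.exp_pos _)
    (fun ω => Real.exp_le_exp.2 (neg_le_neg (hωb ω))) (fun ω => Real.exp_le_exp.2 (neg_le_neg (hωa ω)))
    (cpnMetroProposal_symm hεs.ne' εl) (cpnMetroConst_ne_zero hεs.ne' hεl)
    (smul_cpnRef_le_cpnMetroProposal hεs hεl) hl hπ'

/-- **… and so does the composite sweep** "Metropolis scan, then any exact update" (the engine's
`composite_sweep(..., heatbath='metro')` followed by over-relaxation reflections): for every Markov
kernel `η` leaving `e^{−S} · ⊗(uniform)` invariant, `η ∘ₖ K` converges to `cpnGibbsLaw` from every start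
with the same kind of bound. -/
theorem cpn_metropolisSweep_comp_uniformlyErgodic {εs εl : ℝ} (hεs : 0 < εs) (hεl : 0 < εl)
    {l : List (V ⊕ E)} (hl : ∀ i, i ∈ l) (η : Kernel (CPNConfig V E d) (CPNConfig V E d)) [IsMarkovKernel η]
    (hη : Kernel.Invariant η ((Measure.pi (cpnRef V E d)).withDensity (gibbsDensity (cpnAction src tgt J c)))) :
    ∃ δ : ℝ, 0 < δ ∧ δ ≤ 1 ∧ ∀ (μ₀ : Measure (CPNConfig V E d)) [IsProbabilityMeasure μ₀] (t : ℕ)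
      (A : Set (CPNConfig V E d)),
      |((fun ν : Measure (CPNConfig V E d) => ν.bind (η ∘ₖ cpnMetropolisSweep src tgt J c εs εl l))^[t] μ₀).real A
          - (cpnGibbsLaw src tgt J c).real A| ≤ (1 - δ) ^ t := by
  have hS := continuous_cpnAction src tgt J c
  have hw := measurable_cpnWeight src tgt J c
  haveI := isMarkovKernel_metropolisScan (P := cpnMetroProposal V E d εs εl) hw l
  rcases isEmpty_or_nonempty (CPNConfig V E d) with hE | hne
  · refine ⟨1, one_pos, le_rfl, fun μ₀ _ t A => ?_⟩
    exact absurd (measure_univ (μ := μ₀)) (by rw [Set.univ_eq_empty_iff.2 hE, measure_empty]; exact zero_ne_one)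
  obtain ⟨ωa, -, hmin⟩ := isCompact_univ.exists_isMinOn Set.univ_nonempty hS.continuousOn
  obtain ⟨ωb, -, hmax⟩ := isCompact_univ.exists_isMaxOn Set.univ_nonempty hS.continuousOn
  have hωa : ∀ ω, cpnAction src tgt J c ωa ≤ cpnAction src tgt J c ω := fun ω => (isMinOn_iff.1 hmin) ω (Set.mem_univ ω)
  have hωb : ∀ ω, cpnAction src tgt J c ω ≤ cpnAction src tgt J c ωb := fun ω => (isMaxOn_iff.1 hmax) ω (Set.mem_univ ω)
  set m : ℝ := Real.exp (-cpnAction src tgt J c ωb) with hm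
  set M : ℝ := Real.exp (-cpnAction src tgt J c ωa) with hM
  have hm0 : 0 < m := Real.exp_pos _
  have hwm : ∀ ω, m ≤ cpnWeight src tgt J c ω := fun ω => Real.exp_le_exp.2 (neg_le_neg (hωb ω))
  have hwM : ∀ ω, cpnWeight src tgt J c ω ≤ M := fun ω => Real.exp_le_exp.2 (neg_le_neg (hωa ω))
  have hmin := metropolisScan_minorised (μ := cpnRef V E d) (P := cpnMetroProposal V E d εs εl) hw hm0 hwm hwM
    (smul_cpnRef_le_cpnMetroProposal hεs hεl) hl
  set δE : ℝ≥0∞ := (cpnMetroConst d εs εl * ENNReal.ofReal (m / M)) ^ l.length with hδE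
  have hδ1 : δE ≤ 1 := by
    have h := Measure.le_iff'.1 (hmin ωa) Set.univ
    rw [Measure.smul_apply, smul_eq_mul, measure_univ, mul_one] at h
    exact h.trans prob_le_one
  have hδ0 : δE ≠ 0 := pow_ne_zero _ (mul_ne_zero (cpnMetroConst_ne_zero hεs.ne' hεl)
    (by rw [Ne, ENNReal.ofReal_eq_zero, not_le]; exact div_pos hm0 (Real.exp_pos _)))
  have hδtop : δE ≠ ⊤ := ne_top_of_le_ne_top ENNReal.one_ne_top hδ1
  refine ⟨δE.toReal, ENNReal.toReal_pos hδ0 hδtop, ?_, fun μ₀ _ t A => ?_⟩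
  · exact ENNReal.toReal_le_of_le_ofReal zero_le_one (by rwa [ENNReal.ofReal_one])
  · exact metropolisScan_comp_uniformlyErgodic (μ := cpnRef V E d) (P := cpnMetroProposal V E d εs εl) hw hm0 hwm hwM
      (cpnMetroProposal_symm hεs.ne' εl) (smul_cpnRef_le_cpnMetroProposal hεs hεl) hl η hη μ₀ t A

end CPNMetro

end Summit.Ventures.LatticeQCDFlow.Exactness
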